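import Literature.NumberTheory.Rogawski1990.UnitStableOrbitalIntegralHSideValue           -- ★ (L5) FINAL (B-p10): one-place data, parity flip, the two classes, level-0 value
import Literature.NumberTheory.Automorphic.UnitaryLevelOrbitalIntegralLatticeCountPair     -- ★-twin (F2-H): the `H`-side level socket
import Literature.NumberTheory.Automorphic.SelfDualStableLatticeDepthCountCM               -- ★ A-p13: `exists_ncard_selfDualStable_antidiagTwo_level_eq_sum_at`
import Literature.NumberTheory.Automorphic.SelfDualStableLatticeDepthCount                 -- ★ A-p13: `map_sub_smul_one_le_iff_forall_mem`
import Literature.NumberTheory.Automorphic.FixedCosetsLevelShift                           -- ★ B-p10: `map_eq_self_and_level_iff_map_levelShift_le`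
import HarnessLib

/-!
# The H-side LEVEL values near the identity: `Φ(⟦(δ, γ₁)⟧, 1_{K_H(i)}) = Σ_{j ≤ N−i, j ≡ e} w(j)` per class and `Φ^st(γ_H, 1_{K_H(i)}) = Σ_{j ≤ N−i} w(j)`
# for the type-(1) elliptic torus of `H = U(2) × U(1)` (the fixed BALL of radius `N − i` on the `(q+1)`-regular tree; law «C1» of the S3 table)

Topic `NumberTheory/Rogawski1990`; namespace `Literature.NumberTheory.Automorphic.UnitaryGroup`.  THEOREMS ONLY (no definition, no instance, no notation,
no named fact, no `sorry`).  Cell `pub/hodgecm-mathlib`, crux H413, road «S3-tree» brick **T6 ∕ O8c «H-values near 1»** (T3′ F0P3b-p01 (g11) ask 16:23Z: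
`Φ^st(γ_H, χ₀) = ν·phiH q (N−1)`, `Φ^st(γ_H, χ₁) = ν·(phiH q N − phiH q (N−1))`; END∕T6 holder F0P3a-p03 (g14)).  HC_CM is proved only modulo the cell's 2 remaining
named inputs (hLiu418, h413) until rung 0 closes; this file is unconditional.

THE MATHEMATICS.  Flicker's H-side count [Flicker1998UnitaryFL, §6 p. 95]: the self-dual `γ₂`-stable lattices at `w` are the vertices of the `(q+1)`-regular tree at
distance `≤ N` from the apartment point, `N = v_w(u₀ − u₁)`, split by vertex type (parity) between the two `H`-classes of the stable class.  At LEVEL `i` (test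
function `1_{K_H(i)}`, i.e. «`(h₂)_w ≡ 1 (mod ϖ_w^i)`» on `K_H`) the orbital integral counts the vertices on which `γ₂` acts trivially mod `ϖ^i` (★-twin level socket
`classOrbitalIntegral_level_prod_eq_ncard_selfDual_level`), i.e. (★ A-p13 `exists_ncard_selfDualStable_antidiagTwo_level_eq_sum_at`, whose token `(γ − u₁)Λ ⊆ ϖ^iΛ`
agrees with the socket's `(1 + ϖ^{−i}(γ − 1))Λ ⊆ Λ` as soon as `u₁ ≡ 1 (mod ϖ^i)`, §1) the ball of radius `N − i`: per class the parity-`e` part `Σ_{j ≤ N−i, j ≡ e} w(j)`,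
`w(0) = 1`, `w(j) = q^{j−1}(q+1)`; the two classes carry the two parities (★ (L5-d1) parity flip), so `Φ^st = Σ_{j ≤ N−i} w(j) = phiH q (N − i)` — the level-`0`
value with `N` replaced by `N − i` (law «C1»).

* §1 generic: `map_levelShift_le_iff_map_sub_smul_one_le` (the two tokens), `sum_filter_parity_and_le_add_eq` (parity bookkeeping).
* §2 `exists_classOrbitalIntegral_level_eq_paritySum` — one class.
* §3 `stableOrbitalIntegralRel_level_eq_sum_of_eigenframe` — the stable value (binders `hcpt`, `hreg` as in ★ (L5) FINAL).

## References
* [Flicker1998UnitaryFL] Y. Z. Flicker, *Elementary proof of the fundamental lemma for a unitary group*, Canad. J. Math. 50 (1998), §6 p. 95.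
* [Rogawski1990] J. D. Rogawski, *Automorphic Representations of Unitary Groups in Three Variables* (1990), §4.9 Prop. 4.9.1 (b) p. 55, Lemma 4.9.3 p. 56.
* [Kottwitz1988] R. E. Kottwitz, *Tamagawa numbers*, Ann. of Math. 127 (1988), §2.
* [Serre1979] J.-P. Serre, *Local Fields* (1979), Ch. I §1.  [Serre1980Trees] J.-P. Serre, *Trees* (1980), Ch. II §1.1.  [Macdonald1995] I. G. Macdonald, Ch. V §2.
-/

set_option autoImplicit false

noncomputable section

open MeasureTheory NumberField IsDedekindDomain Matrix Finset ValuativeRel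
open scoped ValuativeRel Matrix MatrixGroups

namespace Literature.NumberTheory.Automorphic.UnitaryGroup

open Literature.NumberTheory.Rogawski1990

/-! ## §1 Generic: the two level tokens agree for deep elements; parity bookkeeping of the ball sums -/

section Generic

variable {F : Type*} [Field F] [ValuativeRel F] {n : ℕ}

/-- For `|y| ≤ C`: `|x| ≤ C ↔ |x − y| ≤ C` (ultrametric). [cite: Serre1979, Ch. I §1] -/
theorem valuation_le_iff_valuation_sub_le {x y : F} {C : ValueGroupWithZero F} (hy : valuation F y ≤ C) :
    valuation F x ≤ C ↔ valuation F (x - y) ≤ C := by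
  constructor
  · intro hx; exact (Valuation.map_sub _ _ _).trans (max_le hx hy)
  · intro h
    have : x = (x - y) + y := by ring
    rw [this]; exact (Valuation.map_add _ _ _).trans (max_le h hy)

/-- **Entrywise, `M − s·1 ≡ 0` iff `M − 1 ≡ 0 (mod c)` when `s ≡ 1 (mod c)`.** [cite: Serre1979, Ch. I §1] -/
theorem forall_valuation_sub_smul_one_apply_le_iff (M : Matrix (Fin n) (Fin n) F) {s c : F} (hs : valuation F (s - 1) ≤ valuation F c) :
    (∀ a b, valuation F ((M - s • (1 : Matrix (Fin n) (Fin n) F)) a b) ≤ valuation F c) ↔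
      ∀ a b, valuation F ((M - 1) a b) ≤ valuation F c := by
  refine forall_congr' fun a => forall_congr' fun b => ?_
  have hab : (M - s • (1 : Matrix (Fin n) (Fin n) F)) a b = (M - 1) a b - (s - 1) * (1 : Matrix (Fin n) (Fin n) F) a b := by
    simp only [Matrix.sub_apply, Matrix.smul_apply, smul_eq_mul]; ring
  have hy : valuation F ((s - 1) * (1 : Matrix (Fin n) (Fin n) F) a b) ≤ valuation F c := by
    by_cases h : a = b
    · rw [h, Matrix.one_apply_eq, mul_one]; exact hs
    · rw [Matrix.one_apply_ne h, mul_zero, map_zero]; exact zero_le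
  rw [hab]
  exact (valuation_le_iff_valuation_sub_le hy).symm

/-- **THE TWO LEVEL TOKENS AGREE ON DEEP ELEMENTS**: for `Λ = Λ(g)` with `γΛ = Λ`, `ϖ` a uniformizer, `1 ≤ i` and `|s − 1| ≤ |ϖ^i|`:
`(1 + ϖ^{−i}(γ − 1))Λ ⊆ Λ` (★ B-p10's token) iff `(γ − s·1)Λ ⊆ ϖ^iΛ` (★ A-p13's token) — both read «`g⁻¹γg ≡ 1 (mod ϖ^i)`» entrywise.
[cite: Kottwitz1988, §2] [cite: Macdonald1995, Ch. V §2] -/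
theorem map_levelShift_le_iff_map_sub_smul_one_le {ϖ : F} (hϖ : IsUniformizingElement ϖ) {i : ℕ} (hi : 1 ≤ i) (γ g : GL (Fin n) F) {s : F}
    (hs : valuation F (s - 1) ≤ valuation F (ϖ ^ i))
    (hst : (Submodule.span 𝒪[F] (Set.range ((g : Matrix (Fin n) (Fin n) F))ᵀ)).map ((Matrix.toLin' ((γ : GL (Fin n) F) : Matrix (Fin n) (Fin n) F)).restrictScalars 𝒪[F]) =
      Submodule.span 𝒪[F] (Set.range ((g : Matrix (Fin n) (Fin n) F))ᵀ)) :
    (Submodule.span 𝒪[F] (Set.range ((g : Matrix (Fin n) (Fin n) F))ᵀ)).map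
          ((Matrix.toLin' (1 + (ϖ ^ i)⁻¹ • (((γ : GL (Fin n) F) : Matrix (Fin n) (Fin n) F) - 1))).restrictScalars 𝒪[F]) ≤
        Submodule.span 𝒪[F] (Set.range ((g : Matrix (Fin n) (Fin n) F))ᵀ) ↔
      (Submodule.span 𝒪[F] (Set.range ((g : Matrix (Fin n) (Fin n) F))ᵀ)).map
          ((Matrix.toLin' (((γ : GL (Fin n) F) : Matrix (Fin n) (Fin n) F) - s • (1 : Matrix (Fin n) (Fin n) F))).restrictScalars 𝒪[F]) ≤
        (Submodule.span 𝒪[F] (Set.range ((g : Matrix (Fin n) (Fin n) F))ᵀ)).map ((Matrix.toLin' (ϖ ^ i • (1 : Matrix (Fin n) (Fin n) F))).restrictScalars 𝒪[F]) := by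
  have h0 := hϖ.ne_zero
  have hc0 : (ϖ : F) ^ i ≠ 0 := pow_ne_zero _ h0
  have hc1 : valuation F (ϖ ^ i) < 1 := by
    rw [← zpow_natCast, ← not_le, show (1 : ValueGroupWithZero F) = valuation F (ϖ ^ (0 : ℤ)) by rw [zpow_zero, map_one], valuation_zpow_le_valuation_zpow_iff hϖ]
    omega
  have key : ∀ z : F, ϖ ^ (-(i : ℤ)) * z ∈ 𝒪[F] ↔ valuation F z ≤ valuation F (ϖ ^ i) := fun z => by
    rw [Valuation.mem_integer_iff, map_mul, _root_.zpow_neg, map_inv₀, ← div_eq_inv_mul, zpow_natCast, div_le_one₀ ((Valuation.pos_iff _).2 hc0)]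
  rw [← map_eq_self_and_level_iff_map_levelShift_le hc0 hc1 γ g, map_sub_smul_one_le_iff_forall_mem h0 γ g s i]
  simp only [key]
  rw [forall_valuation_sub_smul_one_apply_le_iff _ hs]
  exact ⟨fun h => h.2, fun h => ⟨hst, h⟩⟩

/-- **THE TWO PARITY BALL SUMS OF RADIUS `N − i` ADD UP** (`e₀ + e₁ = 1`, `i ≤ N`): `Σ_{j ≡ e₀, j+i ≤ N} f + Σ_{j ≡ e₁, j+i ≤ N} f = Σ_{j ≤ N−i} f`. [cite: Serre1980Trees, Ch. II §1.1] -/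
theorem sum_filter_parity_and_le_add_eq (f : ℕ → ℕ) (N i : ℕ) {e₀ e₁ : ℕ} (hsum : e₀ + e₁ = 1) (hiN : i ≤ N) :
    (∑ j ∈ (Finset.range (N + 1)).filter (fun j => j % 2 = e₀ ∧ j + i ≤ N), f j) +
        ∑ j ∈ (Finset.range (N + 1)).filter (fun j => j % 2 = e₁ ∧ j + i ≤ N), f j =
      ∑ j ∈ Finset.range (N - i + 1), f j := by
  have hrange : (Finset.range (N + 1)).filter (fun j => j + i ≤ N) = Finset.range (N - i + 1) := by
    ext j; simp only [Finset.mem_filter, Finset.mem_range]; omega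
  rw [← hrange, ← Finset.sum_filter_add_sum_filter_not ((Finset.range (N + 1)).filter (fun j => j + i ≤ N)) (fun j => j % 2 = e₀) f,
    Finset.filter_filter, Finset.filter_filter]
  congr 1
  · exact Finset.sum_congr (Finset.filter_congr fun j _ => by tauto) fun _ _ => rfl
  · exact Finset.sum_congr (Finset.filter_congr fun j _ => by constructor <;> intro h <;> omega) fun _ _ => rfl

end Generic

/-! ## §2–§3 The H-side level values at a non-split unramified place -/

section CM

variable (L : Type) [Field L] [NumberField L] [IsCMField L] (v : HeightOneSpectrum (𝓞 ↥(maximalRealSubfield L)))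
  (w : PlacesOver L v) (hw : IsCMField.complexConj L • w.1 = w.1)

/-- **`Φ^st(γ_H, f) = S₀ + S₁`** when the stable class of `γ_H = (γ₂, γ₁)` is the two classes `⟦(γ₂, γ₁)⟧, ⟦(γ₂′, γ₁)⟧` with values `S₀, S₁` — ★ (L5) HEAD SKELETON's
`…_of_two_classes_of_values` for a general test function (term-mode `Eq.trans` chain; no `rw` on the CM carrier). [cite: Rogawski1990, §4.1 (4.1.1) p. 39] -/
theorem stableOrbitalIntegralRel_eq_natCast_of_two_classes_of_values
    [∀ a : ((cmDatum L 2 (Matrix.of fun i j : Fin 2 => if i.val + j.val + 1 = 2 then (1 : L) else 0)).Local v × (cmDatum L 1 (Matrix.of fun i j : Fin 1 => if i.val + j.val + 1 = 1 then (1 : L) else 0)).Local v), MeasurableSpace (((cmDatum L 2 (Matrix.of fun i j : Fin 2 => if i.val + j.val + 1 = 2 then (1 : L) else 0)).Local v × (cmDatum L 1 (Matrix.of fun i j : Fin 1 => if i.val + j.val + 1 = 1 then (1 : L) else 0)).Local v) ⧸ Subgroup.centralizer ({a} : Set ((cmDatum L 2 (Matrix.of fun i j : Fin 2 => if i.val +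 j.val + 1 = 2 then (1 : L) else 0)).Local v × (cmDatum L 1 (Matrix.of fun i j : Fin 1 => if i.val + j.val + 1 = 1 then (1 : L) else 0)).Local v)))]
    (mH : OrbitalMeasureFamily ((cmDatum L 2 (Matrix.of fun i j : Fin 2 => if i.val + j.val + 1 = 2 then (1 : L) else 0)).Local v ×
      (cmDatum L 1 (Matrix.of fun i j : Fin 1 => if i.val + j.val + 1 = 1 then (1 : L) else 0)).Local v))
    (f : (cmDatum L 2 (Matrix.of fun i j : Fin 2 => if i.val + j.val + 1 = 2 then (1 : L) else 0)).Local v ×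
      (cmDatum L 1 (Matrix.of fun i j : Fin 1 => if i.val + j.val + 1 = 1 then (1 : L) else 0)).Local v → ℂ)
    (γ₂ γ₂' : (cmDatum L 2 (Matrix.of fun i j : Fin 2 => if i.val + j.val + 1 = 2 then (1 : L) else 0)).Local v)
    (γ₁ : (cmDatum L 1 (Matrix.of fun i j : Fin 1 => if i.val + j.val + 1 = 1 then (1 : L) else 0)).Local v)
    (hst : IsStablyConj (conjLocal L (IsCMField.complexConj L) v)
      ((UnitaryGroup.adelicForm L 2 (Matrix.of fun i j : Fin 2 => if i.val + j.val + 1 = 2 then (1 : L) else 0)).map (UnitaryGroup.adeleToLocal L v)) γ₂ γ₂')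
    (hnc : ¬ IsConj γ₂ γ₂')
    (hall : ∀ δ, IsStablyConj (conjLocal L (IsCMField.complexConj L) v)
      ((UnitaryGroup.adelicForm L 2 (Matrix.of fun i j : Fin 2 => if i.val + j.val + 1 = 2 then (1 : L) else 0)).map (UnitaryGroup.adeleToLocal L v)) γ₂ δ → IsConj γ₂ δ ∨ IsConj γ₂' δ)
    {S₀ S₁ S : ℕ}
    (h₀ : classOrbitalIntegral mH f (ConjClasses.mk (γ₂, γ₁)) = (S₀ : ℂ))
    (h₁ : classOrbitalIntegral mH f (ConjClasses.mk (γ₂', γ₁)) = (S₁ : ℂ))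
    (hS : S₀ + S₁ = S) :
    stableOrbitalIntegralRel (IsLocalStablyConjH L v) mH f (γ₂, γ₁) = (S : ℂ) :=
  -- no `rw` on the CM-carrier goal: an `Eq.trans` chain down to pure arithmetic (elaboration hygiene, B-p10 (g24) 03:00Z lesson)
  (two_classes_prod_of_two_classes_fst (conjLocal L (IsCMField.complexConj L) v)
    ((UnitaryGroup.adelicForm L 2 (Matrix.of fun i j : Fin 2 => if i.val + j.val + 1 = 2 then (1 : L) else 0)).map (UnitaryGroup.adeleToLocal L v))
    ((UnitaryGroup.adelicForm L 1 (Matrix.of fun i j : Fin 1 => if i.val + j.val + 1 = 1 then (1 : L) else 0)).map (UnitaryGroup.adeleToLocal L v))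
    γ₁ hst hnc hall).elim fun hstH hrest =>
  (stableOrbitalIntegralRel_eq_add_of_two_classes (IsLocalStablyConjH L v) mH _ (γ₂, γ₁) (γ₂', γ₁) (isLocalStablyConjH_of_isConj_and_conj L (γ₂, γ₁)).1
    (isLocalStablyConjH_of_isConj_and_conj L (γ₂, γ₁)).2 hstH hrest.1 hrest.2).trans
    (((congrArg₂ (· + ·) h₀ h₁).trans (by rw [← Nat.cast_add, hS])))

variable
  [MeasurableSpace ((cmDatum L 2 (Matrix.of fun i j : Fin 2 => if i.val + j.val + 1 = 2 then (1 : L) else 0)).Local v × (cmDatum L 1 (Matrix.of fun i j : Fin 1 => if i.val + j.val + 1 = 1 then (1 : L) else 0)).Local v)] [BorelSpace ((cmDatum L 2 (Matrix.of fun i j : Fin 2 => if i.val + j.val + 1 = 2 then (1 : L) else 0)).Local v × (cmDatum L 1 (Matrix.of fun i j : Fin 1 => if i.val + j.val + 1 = 1 then (1 : L) else 0)).Local v)]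
  [∀ a : (cmDatum L 2 (Matrix.of fun i j : Fin 2 => if i.val + j.val + 1 = 2 then (1 : L) else 0)).Local v × (cmDatum L 1 (Matrix.of fun i j : Fin 1 => if i.val + j.val + 1 = 1 then (1 : L) else 0)).Local v, MeasurableSpace (((cmDatum L 2 (Matrix.of fun i j : Fin 2 => if i.val + j.val + 1 = 2 then (1 : L) else 0)).Local v × (cmDatum L 1 (Matrix.of fun i j : Fin 1 => if i.val + j.val + 1 = 1 then (1 : L) else 0)).Local v) ⧸ Subgroup.centralizer ({a} : Set ((cmDatum L 2 (Matrix.of fun i j : Fin 2 => if i.val + j.val + 1 = 2 then (1 : L) else 0)).Local v × (cmDatum L 1 (Matrix.of fun i j : Fin 1 => if i.val + j.val + 1 = 1 then (1 : L) else 0)).Local v)))]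
  [∀ a : (cmDatum L 2 (Matrix.of fun i j : Fin 2 => if i.val + j.val + 1 = 2 then (1 : L) else 0)).Local v × (cmDatum L 1 (Matrix.of fun i j : Fin 1 => if i.val + j.val + 1 = 1 then (1 : L) else 0)).Local v, BorelSpace (((cmDatum L 2 (Matrix.of fun i j : Fin 2 => if i.val + j.val + 1 = 2 then (1 : L) else 0)).Local v × (cmDatum L 1 (Matrix.of fun i j : Fin 1 => if i.val + j.val + 1 = 1 then (1 : L) else 0)).Local v) ⧸ Subgroup.centralizer ({a} : Set ((cmDatum L 2 (Matrix.of fun i j : Fin 2 => if i.val + j.val + 1 = 2 then (1 : L) else 0)).Local v × (cmDatum L 1 (Matrix.of fun i j : Fin 1 => if i.val + j.val + 1 = 1 then (1 : L) else 0)).Local v)))]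
  (νH : Measure ((cmDatum L 2 (Matrix.of fun i j : Fin 2 => if i.val + j.val + 1 = 2 then (1 : L) else 0)).Local v × (cmDatum L 1 (Matrix.of fun i j : Fin 1 => if i.val + j.val + 1 = 1 then (1 : L) else 0)).Local v)) [νH.IsHaarMeasure] [νH.IsMulRightInvariant]

include hw in
/-- **THE LEVEL-`i` VALUE OF ONE CLASS**: for `δ ∈ U(Φ₂)(L⁺_v)` with an eigenframe `δ Q = Q · diag(u)` on `E_v` (`u₀ ≠ u₁` of norm one, `|u₀ − u₁|_w = |ϖ^N|`,
`|u₁ − 1|_w ≤ |ϖ^i|`, `1 ≤ i`), `Z(δ)` compact and `(δ, γ₁)` `G`-regular, at a non-split `v` unramified in `L`, `m_H` canonical, `ν_H(K₂ ×ˢ K₁) = 1`, and `f` the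
level-`ϖ_w^i` class function on `K_H` (continuous, supported in `K_H`, `K_H`-conjugation invariant, `= [(h₂)_w ≡ 1 (mod ϖ_w^i)]` on `K_H`):
`Φ(⟦(δ, γ₁)⟧, f) = Σ_{j ≤ N − i, j ≡ e} w(j)` for an `e ∈ {0, 1}` with `e = 0 ⟺` the order of `⟨q₀, q₀⟩` at `w` is even — the fixed BALL of radius `N − i`, type-`e` vertices
(★-twin `H`-side level socket ∘ ★ A-p13 `exists_ncard_selfDualStable_antidiagTwo_level_eq_sum_at` ∘ §1 token bridge). [cite: Flicker1998UnitaryFL, §6 p. 95]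
[cite: Rogawski1990, §4.9 Prop. 4.9.1 (b) p. 55] [cite: Kottwitz1988, §2] -/
theorem exists_classOrbitalIntegral_level_eq_paritySum (hunr : Algebra.IsUnramifiedIn (𝓞 L) v.asIdeal)
    {mH : OrbitalMeasureFamily ((cmDatum L 2 (Matrix.of fun i j : Fin 2 => if i.val + j.val + 1 = 2 then (1 : L) else 0)).Local v × (cmDatum L 1 (Matrix.of fun i j : Fin 1 => if i.val + j.val + 1 = 1 then (1 : L) else 0)).Local v)} (hmH : mH.IsCanonical (IsLocalGRegular L v) νH)
    (hνH : νH (((cmLocalIntegralLevel L 2 (Matrix.of fun i j : Fin 2 => if i.val + j.val + 1 = 2 then (1 : L) else 0) v).prod (cmLocalIntegralLevel L 1 (Matrix.of fun i j : Fin 1 => if i.val + j.val + 1 = 1 then (1 : L) else 0) v) : Subgroup ((cmDatum L 2 (Matrix.of fun i j : Fin 2 => if i.val + j.val + 1 = 2 then (1 : L) else 0)).Local v × (cmDatum L 1 (Matrix.of fun i j : Fin 1 => if i.val + j.val + 1 = 1 then (1 : L) else 0)).Local v)) : Set ((cmDatum L 2 (Matrix.of fun i j : Fin 2 => if i.val +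 j.val + 1 = 2 then (1 : L) else 0)).Local v × (cmDatum L 1 (Matrix.of fun i j : Fin 1 => if i.val + j.val + 1 = 1 then (1 : L) else 0)).Local v)) = 1)
    (δ : (cmDatum L 2 (Matrix.of fun i j : Fin 2 => if i.val + j.val + 1 = 2 then (1 : L) else 0)).Local v) (γ₁ : (cmDatum L 1 (Matrix.of fun i j : Fin 1 => if i.val + j.val + 1 = 1 then (1 : L) else 0)).Local v) (hγ : IsLocalGRegular L v (δ, γ₁))
    [CompactSpace (Subgroup.centralizer ({δ} : Set ((cmDatum L 2 (Matrix.of fun i j : Fin 2 => if i.val + j.val + 1 = 2 then (1 : L) else 0)).Local v)))]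
    {Q : GL (Fin 2) (LocalRing L v)} {u : Fin 2 → LocalRing L v}
    (hQ : δ.val.val * Q.val = Q.val * diagonal u)
    (hu : Function.Injective u) (hu1 : ∀ i, conjLocal L (IsCMField.complexConj L) v (u i) * u i = 1) {N : ℕ}
    (hN : valuation (w.1.adicCompletion L) (u 0 w - u 1 w) = valuation (w.1.adicCompletion L) ((toPlace v w (GaloisRepresentations.HeckeCharacter.uniformizer ↥(maximalRealSubfield L) v : v.adicCompletion ↥(maximalRealSubfield L))) ^ N))
    {i : ℕ} (hi : 1 ≤ i) (hui : valuation (w.1.adicCompletion L) (u 1 w - 1) ≤ valuation (w.1.adicCompletion L) ((toPlace v w (GaloisRepresentations.HeckeCharacter.uniformizer ↥(maximalRealSubfield L) v : v.adicCompletion ↥(maximalRealSubfield L))) ^ i))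
    (f : ((cmDatum L 2 (Matrix.of fun i j : Fin 2 => if i.val + j.val + 1 = 2 then (1 : L) else 0)).Local v × (cmDatum L 1 (Matrix.of fun i j : Fin 1 => if i.val + j.val + 1 = 1 then (1 : L) else 0)).Local v) → ℂ) (hfc : Continuous f) (hfK : Function.support f ⊆ ((((cmLocalIntegralLevel L 2 (Matrix.of fun i j : Fin 2 => if i.val + j.val + 1 = 2 then (1 : L) else 0) v).prod (cmLocalIntegralLevel L 1 (Matrix.of fun i j : Fin 1 => if i.val + j.val + 1 = 1 then (1 : L) else 0) v) : Subgroup ((cmDatum L 2 (Matrix.of fun i j : Fin 2 => if i.val + j.val + 1 = 2 then (1 : L) else 0)).Local v × (cmDatum L 1 (Matrix.of fun i j : Fin 1 => if i.val + j.val + 1 = 1 then (1 : L) else 0)).Local v))) : Set ((cmDatum L 2 (Matrix.of fun i j : Fin 2 => if i.val + j.val + 1 = 2 then (1 : L) else 0)).Local v × (cmDatum L 1 (Matrix.of fun i j : Fin 1 => if i.val + j.val + 1 = 1 then (1 : L) else 0)).Local v)))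
    (hfinv : ∀ k ∈ (((cmLocalIntegralLevel L 2 (Matrix.of fun i j : Fin 2 => if i.val + j.val + 1 = 2 then (1 : L) else 0) v).prod (cmLocalIntegralLevel L 1 (Matrix.of fun i j : Fin 1 => if i.val + j.val + 1 = 1 then (1 : L) else 0) v) : Subgroup ((cmDatum L 2 (Matrix.of fun i j : Fin 2 => if i.val + j.val + 1 = 2 then (1 : L) else 0)).Local v × (cmDatum L 1 (Matrix.of fun i j : Fin 1 => if i.val + j.val + 1 = 1 then (1 : L) else 0)).Local v))), ∀ x, f (k * x * k⁻¹) = f x)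
    (hf1 : ∀ x ∈ (((cmLocalIntegralLevel L 2 (Matrix.of fun i j : Fin 2 => if i.val + j.val + 1 = 2 then (1 : L) else 0) v).prod (cmLocalIntegralLevel L 1 (Matrix.of fun i j : Fin 1 => if i.val + j.val + 1 = 1 then (1 : L) else 0) v) : Subgroup ((cmDatum L 2 (Matrix.of fun i j : Fin 2 => if i.val + j.val + 1 = 2 then (1 : L) else 0)).Local v × (cmDatum L 1 (Matrix.of fun i j : Fin 1 => if i.val + j.val + 1 = 1 then (1 : L) else 0)).Local v))), (∀ a b, valuation (w.1.adicCompletion L) (((((((localNonsplitEquiv (IsCMField.complexConj L) (Matrix.of fun i j : Fin 2 => if i.val + j.val + 1 = 2 then (1 : L) else 0) (IsCMField.complexConj_ne_one L) w hw) x.1 : ↥(unitaryGroupOfForm (galAdicCompletionMap (L := L) (IsCMField.complexConj L) hw) (placeForm (Matrix.of fun i j : Fin 2 => if i.val + j.val + 1 = 2 then (1 : L) else 0) w.1))) : GL (Fin 2) (w.1.adicCompletion L))) : Matrix (Fin 2) (Fin 2) (w.1.adicCompletion L)) - 1) a b) ≤ valuation (w.1.adicCompletion L) ((toPlace v w (GaloisRepresentations.HeckeCharacter.uniformizer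 ↥(maximalRealSubfield L) v : v.adicCompletion ↥(maximalRealSubfield L))) ^ i)) → f x = 1)
    (hf0 : ∀ x ∈ (((cmLocalIntegralLevel L 2 (Matrix.of fun i j : Fin 2 => if i.val + j.val + 1 = 2 then (1 : L) else 0) v).prod (cmLocalIntegralLevel L 1 (Matrix.of fun i j : Fin 1 => if i.val + j.val + 1 = 1 then (1 : L) else 0) v) : Subgroup ((cmDatum L 2 (Matrix.of fun i j : Fin 2 => if i.val + j.val + 1 = 2 then (1 : L) else 0)).Local v × (cmDatum L 1 (Matrix.of fun i j : Fin 1 => if i.val + j.val + 1 = 1 then (1 : L) else 0)).Local v))), ¬ (∀ a b, valuation (w.1.adicCompletion L) (((((((localNonsplitEquiv (IsCMField.complexConj L) (Matrix.of fun i j : Fin 2 => if i.val + j.val + 1 = 2 then (1 : L) else 0) (IsCMField.complexConj_ne_one L) w hw) x.1 : ↥(unitaryGroupOfForm (galAdicCompletionMap (L := L) (IsCMField.complexConj L) hw) (placeForm (Matrix.of fun i j : Fin 2 => if i.val + j.val + 1 = 2 then (1 : L) else 0) w.1))) : GL (Fin 2) (w.1.adicCompletion L))) : Matrix (Fin 2)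 (Fin 2) (w.1.adicCompletion L)) - 1) a b) ≤ valuation (w.1.adicCompletion L) ((toPlace v w (GaloisRepresentations.HeckeCharacter.uniformizer ↥(maximalRealSubfield L) v : v.adicCompletion ↥(maximalRealSubfield L))) ^ i)) → f x = 0) :
    ∃ e : ℕ, e ≤ 1 ∧
      (Even (WithZero.log (Valued.v ((twistGram (conjLocal L (IsCMField.complexConj L) v) ((adelicForm L 2 (Matrix.of fun i j : Fin 2 => if i.val + j.val + 1 = 2 then (1 : L) else 0)).map (adeleToLocal L v)) Q.val 0 0) w))) ↔ e = 0) ∧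
      classOrbitalIntegral mH f (ConjClasses.mk (δ, γ₁)) =
        ((∑ j ∈ (range (N + 1)).filter (fun j => j % 2 = e ∧ j + i ≤ N), (if j = 0 then 1 else Nat.card (𝓞 ↥(maximalRealSubfield L) ⧸ v.asIdeal) ^ (j - 1) * (Nat.card (𝓞 ↥(maximalRealSubfield L) ⧸ v.asIdeal) + 1)) : ℕ) : ℂ) := by
  have hc1 : IsCMField.complexConj L ≠ 1 := IsCMField.complexConj_ne_one L
  -- the one-place data
  have hδw : (((localNonsplitEquiv (IsCMField.complexConj L) (Matrix.of fun i j : Fin 2 => if i.val + j.val + 1 = 2 then (1 : L) else 0) hc1 w hw δ :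
      unitaryGroupOfForm (galAdicCompletionMap (L := L) (IsCMField.complexConj L) hw) (placeForm (Matrix.of fun i j : Fin 2 => if i.val + j.val + 1 = 2 then (1 : L) else 0) w.1)) :
        GL (Fin 2) (w.1.adicCompletion L)) ∈
      Literature.AlgebraicGeometry.ShimuraVarieties.unitaryGroup (galAdicCompletionMap (L := L) (IsCMField.complexConj L) hw) (placeForm (Matrix.of fun i j : Fin 2 => if i.val + j.val + 1 = 2 then (1 : L) else 0) w.1)) :=
    Literature.AlgebraicGeometry.ShimuraVarieties.mem_unitaryGroup_iff.2
      (mem_unitaryGroupOfForm_iff.1 (localNonsplitEquiv (IsCMField.complexConj L) (Matrix.of fun i j : Fin 2 => if i.val + j.val + 1 = 2 then (1 : L) else 0) hc1 w hw δ).2)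
  have hQw : (((localNonsplitEquiv (IsCMField.complexConj L) (Matrix.of fun i j : Fin 2 => if i.val + j.val + 1 = 2 then (1 : L) else 0) hc1 w hw δ :
      unitaryGroupOfForm (galAdicCompletionMap (L := L) (IsCMField.complexConj L) hw) (placeForm (Matrix.of fun i j : Fin 2 => if i.val + j.val + 1 = 2 then (1 : L) else 0) w.1)) :
        GL (Fin 2) (w.1.adicCompletion L)) : Matrix (Fin 2) (Fin 2) (w.1.adicCompletion L)) *
        (Matrix.GeneralLinearGroup.map (Pi.evalRingHom (fun w' : PlacesOver L v => w'.1.adicCompletion L) w) Q :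
          Matrix (Fin 2) (Fin 2) (w.1.adicCompletion L)) =
      (Matrix.GeneralLinearGroup.map (Pi.evalRingHom (fun w' : PlacesOver L v => w'.1.adicCompletion L) w) Q :
          Matrix (Fin 2) (Fin 2) (w.1.adicCompletion L)) * diagonal fun i => u i w := by
    rw [coe_localNonsplitEquiv_apply L (Matrix.of fun i j : Fin 2 => if i.val + j.val + 1 = 2 then (1 : L) else 0) v w hw δ]
    exact map_eval_mul_eq_of_eigenframe L v w hQ
  obtain ⟨huw, hu1w⟩ := injective_eval_and_norm_one_of_eigenvalues L v w hw hu hu1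
  -- the uniformizer `ϖ_w` and the level `c = ϖ_w^i`
  have hϖv := Liu2021.LemD1IndexedNonVacuityInertCofinite.valued_toPlace_uniformizer_of_isUnramifiedIn L v hunr w
  have hϖ := isUniformizingElement_of_v_eq hϖv
  have hc0 : (toPlace v w (GaloisRepresentations.HeckeCharacter.uniformizer ↥(maximalRealSubfield L) v : v.adicCompletion ↥(maximalRealSubfield L))) ^ i ≠ 0 := pow_ne_zero _ hϖ.ne_zero
  have hcv : valuation (w.1.adicCompletion L) ((toPlace v w (GaloisRepresentations.HeckeCharacter.uniformizer ↥(maximalRealSubfield L) v : v.adicCompletion ↥(maximalRealSubfield L))) ^ i) < 1 := by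
    rw [← zpow_natCast, ← not_le, show (1 : ValueGroupWithZero (w.1.adicCompletion L)) = valuation (w.1.adicCompletion L) ((toPlace v w (GaloisRepresentations.HeckeCharacter.uniformizer ↥(maximalRealSubfield L) v : v.adicCompletion ↥(maximalRealSubfield L))) ^ (0 : ℤ)) by
      rw [zpow_zero, map_one], valuation_zpow_le_valuation_zpow_iff hϖ]
    omega
  obtain ⟨e, he, hpar, hcount⟩ := exists_ncard_selfDualStable_antidiagTwo_level_eq_sum_at L v w hw hunr hδw hQw huw hu1w hN i
  -- parity currency: one-place `twistGram` = CM `twistGram` read at `w`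
  have hpf : twistGram (galAdicCompletionMap (L := L) (IsCMField.complexConj L) hw) (placeForm (Matrix.of fun i j : Fin 2 => if i.val + j.val + 1 = 2 then (1 : L) else 0) w.1)
      (Matrix.GeneralLinearGroup.map (Pi.evalRingHom (fun w' : PlacesOver L v => w'.1.adicCompletion L) w) Q).val 0 0 =
      (twistGram (conjLocal L (IsCMField.complexConj L) v) ((adelicForm L 2 (Matrix.of fun i j : Fin 2 => if i.val + j.val + 1 = 2 then (1 : L) else 0)).map (adeleToLocal L v)) Q.val 0 0) w := by
    rw [← localForm_map_eval L 2 (Matrix.of fun i j : Fin 2 => if i.val + j.val + 1 = 2 then (1 : L) else 0) v w]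
    exact (twistGram_apply_eval L v w hw _ _ 0 0).symm
  refine ⟨e, he, by rw [← hpf]; exact hpar, ?_⟩
  refine (classOrbitalIntegral_level_prod_eq_ncard_selfDual_level L v νH hmH hνH (δ, γ₁) hγ w hw hunr hc0 hcv f hfc hfK hfinv hf1 hf0).trans ?_
  rw [← hcount]
  congr 1
  congr 1
  ext Λ
  simp only [Set.mem_setOf_eq]
  constructor
  · rintro ⟨⟨g, hJ, rfl⟩, hst, hlev⟩
    exact ⟨⟨⟨g, hJ, rfl⟩, hst⟩, (map_levelShift_le_iff_map_sub_smul_one_le hϖ hi _ g hui hst).1 hlev⟩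
  · rintro ⟨⟨⟨g, hJ, rfl⟩, hst⟩, hlev⟩
    exact ⟨⟨g, hJ, rfl⟩, hst, (map_levelShift_le_iff_map_sub_smul_one_le hϖ hi _ g hui hst).2 hlev⟩

include hw in
/-- **THE LEVEL-`i` H-SIDE STABLE VALUE: `Φ^st(γ_H, f) = Σ_{j ≤ N − i} w(j)` (`= phiH q (N − i)`, the full fixed ball of radius `N − i`: `w(0) = 1`, `w(j) = q^{j−1}(q+1)`)** —
the law «C1» of the S3 table on the type-(1) torus: same frame as ★ `stableOrbitalIntegralRel_indicator_eq_flicker_of_eigenframe` (`γ₂` elliptic regular of type (1) with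
eigenframe `γ₂ P = P·diag(u)`, `N = v_w(u₀ − u₁)`), plus `1 ≤ i ≤ N` and `|u₁ − 1|_w ≤ |ϖ^i|` (`γ_H` deep enough), `f` the level-`ϖ_w^i` class function on `K_H`.  The two classes of
the stable class carry the two parities (★ (L5-d1) parity flip) and the parity sums of radius `N − i` add up (§1). BINDERS `hcpt`, `hreg` as in ★ (L5) FINAL.
[cite: Flicker1998UnitaryFL, §6 p. 95] [cite: Rogawski1990, §4.9 Lemma 4.9.3 p. 56; §4.1 (4.1.1) p. 39] [cite: Kottwitz1988, §2] -/
theorem stableOrbitalIntegralRel_level_eq_sum_of_eigenframe (hunr : Algebra.IsUnramifiedIn (𝓞 L) v.asIdeal)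
    {mH : OrbitalMeasureFamily ((cmDatum L 2 (Matrix.of fun i j : Fin 2 => if i.val + j.val + 1 = 2 then (1 : L) else 0)).Local v × (cmDatum L 1 (Matrix.of fun i j : Fin 1 => if i.val + j.val + 1 = 1 then (1 : L) else 0)).Local v)} (hmH : mH.IsCanonical (IsLocalGRegular L v) νH)
    (hνH : νH (((cmLocalIntegralLevel L 2 (Matrix.of fun i j : Fin 2 => if i.val + j.val + 1 = 2 then (1 : L) else 0) v).prod (cmLocalIntegralLevel L 1 (Matrix.of fun i j : Fin 1 => if i.val + j.val + 1 = 1 then (1 : L) else 0) v) : Subgroup ((cmDatum L 2 (Matrix.of fun i j : Fin 2 => if i.val + j.val + 1 = 2 then (1 : L) else 0)).Local v × (cmDatum L 1 (Matrix.of fun i j : Fin 1 => if i.val + j.val + 1 = 1 then (1 : L) else 0)).Local v)) : Set ((cmDatum L 2 (Matrix.of fun i j : Fin 2 => if i.val + j.val + 1 = 2 then (1 : L) else 0)).Local v × (cmDatum L 1 (Matrix.of fun i j : Fin 1 => if i.val + j.val + 1 = 1 then (1 : L) else 0)).Local v)) = 1)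
    (γ₂ : (cmDatum L 2 (Matrix.of fun i j : Fin 2 => if i.val + j.val + 1 = 2 then (1 : L) else 0)).Local v) (γ₁ : (cmDatum L 1 (Matrix.of fun i j : Fin 1 => if i.val + j.val + 1 = 1 then (1 : L) else 0)).Local v) (hγ : IsLocalGRegular L v (γ₂, γ₁))
    [CompactSpace (Subgroup.centralizer ({γ₂} : Set ((cmDatum L 2 (Matrix.of fun i j : Fin 2 => if i.val + j.val + 1 = 2 then (1 : L) else 0)).Local v)))]
    {P : GL (Fin 2) (LocalRing L v)} {u : Fin 2 → LocalRing L v}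
    (hP : γ₂.val.val * P.val = P.val * diagonal u)
    (hu : Function.Injective u) (hu1 : ∀ i, conjLocal L (IsCMField.complexConj L) v (u i) * u i = 1) {N : ℕ}
    (hN : valuation (w.1.adicCompletion L) (u 0 w - u 1 w) = valuation (w.1.adicCompletion L) ((toPlace v w (GaloisRepresentations.HeckeCharacter.uniformizer ↥(maximalRealSubfield L) v : v.adicCompletion ↥(maximalRealSubfield L))) ^ N))
    {i : ℕ} (hi : 1 ≤ i) (hui : valuation (w.1.adicCompletion L) (u 1 w - 1) ≤ valuation (w.1.adicCompletion L) ((toPlace v w (GaloisRepresentations.HeckeCharacter.uniformizer ↥(maximalRealSubfield L) v : v.adicCompletion ↥(maximalRealSubfield L))) ^ i))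
    (f : ((cmDatum L 2 (Matrix.of fun i j : Fin 2 => if i.val + j.val + 1 = 2 then (1 : L) else 0)).Local v × (cmDatum L 1 (Matrix.of fun i j : Fin 1 => if i.val + j.val + 1 = 1 then (1 : L) else 0)).Local v) → ℂ) (hfc : Continuous f) (hfK : Function.support f ⊆ ((((cmLocalIntegralLevel L 2 (Matrix.of fun i j : Fin 2 => if i.val + j.val + 1 = 2 then (1 : L) else 0) v).prod (cmLocalIntegralLevel L 1 (Matrix.of fun i j : Fin 1 => if i.val + j.val + 1 = 1 then (1 : L) else 0) v) : Subgroup ((cmDatum L 2 (Matrix.of fun i j : Fin 2 => if i.val + j.val + 1 = 2 then (1 : L) else 0)).Local v × (cmDatum L 1 (Matrix.of fun i j : Fin 1 => if i.val + j.val + 1 = 1 then (1 : L) else 0)).Local v))) : Set ((cmDatum L 2 (Matrix.of fun i j : Fin 2 => if i.val + j.val + 1 = 2 then (1 : L) else 0)).Local v × (cmDatum L 1 (Matrix.of fun i j : Fin 1 => if i.val + j.val + 1 = 1 then (1 : L) else 0)).Local v)))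
    (hfinv : ∀ k ∈ (((cmLocalIntegralLevel L 2 (Matrix.of fun i j : Fin 2 => if i.val + j.val + 1 = 2 then (1 : L) else 0) v).prod (cmLocalIntegralLevel L 1 (Matrix.of fun i j : Fin 1 => if i.val + j.val + 1 = 1 then (1 : L) else 0) v) : Subgroup ((cmDatum L 2 (Matrix.of fun i j : Fin 2 => if i.val + j.val + 1 = 2 then (1 : L) else 0)).Local v × (cmDatum L 1 (Matrix.of fun i j : Fin 1 => if i.val + j.val + 1 = 1 then (1 : L) else 0)).Local v))), ∀ x, f (k * x * k⁻¹) = f x)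
    (hf1 : ∀ x ∈ (((cmLocalIntegralLevel L 2 (Matrix.of fun i j : Fin 2 => if i.val + j.val + 1 = 2 then (1 : L) else 0) v).prod (cmLocalIntegralLevel L 1 (Matrix.of fun i j : Fin 1 => if i.val + j.val + 1 = 1 then (1 : L) else 0) v) : Subgroup ((cmDatum L 2 (Matrix.of fun i j : Fin 2 => if i.val + j.val + 1 = 2 then (1 : L) else 0)).Local v × (cmDatum L 1 (Matrix.of fun i j : Fin 1 => if i.val + j.val + 1 = 1 then (1 : L) else 0)).Local v))), (∀ a b, valuation (w.1.adicCompletion L) (((((((localNonsplitEquiv (IsCMField.complexConj L) (Matrix.of fun i j : Fin 2 => if i.val + j.val + 1 = 2 then (1 : L) else 0) (IsCMField.complexConj_ne_one L) w hw) x.1 : ↥(unitaryGroupOfForm (galAdicCompletionMap (L := L) (IsCMField.complexConj L) hw) (placeForm (Matrix.of fun i j : Fin 2 => if i.val + j.val + 1 = 2 then (1 : L) else 0) w.1))) : GL (Fin 2) (w.1.adicCompletion L))) : Matrix (Fin 2) (Fin 2) (w.1.adicCompletion L)) - 1) a b) ≤ valuation (w.1.adicCompletion L) ((toPlace v w (GaloisRepresentations.HeckeCharacter.uniformizer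 ↥(maximalRealSubfield L) v : v.adicCompletion ↥(maximalRealSubfield L))) ^ i)) → f x = 1)
    (hf0 : ∀ x ∈ (((cmLocalIntegralLevel L 2 (Matrix.of fun i j : Fin 2 => if i.val + j.val + 1 = 2 then (1 : L) else 0) v).prod (cmLocalIntegralLevel L 1 (Matrix.of fun i j : Fin 1 => if i.val + j.val + 1 = 1 then (1 : L) else 0) v) : Subgroup ((cmDatum L 2 (Matrix.of fun i j : Fin 2 => if i.val + j.val + 1 = 2 then (1 : L) else 0)).Local v × (cmDatum L 1 (Matrix.of fun i j : Fin 1 => if i.val + j.val + 1 = 1 then (1 : L) else 0)).Local v))), ¬ (∀ a b, valuation (w.1.adicCompletion L) (((((((localNonsplitEquiv (IsCMField.complexConj L) (Matrix.of fun i j : Fin 2 => if i.val + j.val + 1 = 2 then (1 : L) else 0) (IsCMField.complexConj_ne_one L) w hw) x.1 : ↥(unitaryGroupOfForm (galAdicCompletionMap (L := L) (IsCMField.complexConj L) hw) (placeForm (Matrix.of fun i j : Fin 2 => if i.val + j.val + 1 = 2 then (1 : L) else 0) w.1))) : GL (Fin 2) (w.1.adicCompletion L))) : Matrix (Fin 2)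 (Fin 2) (w.1.adicCompletion L)) - 1) a b) ≤ valuation (w.1.adicCompletion L) ((toPlace v w (GaloisRepresentations.HeckeCharacter.uniformizer ↥(maximalRealSubfield L) v : v.adicCompletion ↥(maximalRealSubfield L))) ^ i)) → f x = 0) (hiN : i ≤ N)
    (hcpt : ∀ δ : (cmDatum L 2 (Matrix.of fun i j : Fin 2 => if i.val + j.val + 1 = 2 then (1 : L) else 0)).Local v, IsStablyConj (conjLocal L (IsCMField.complexConj L) v) ((adelicForm L 2 (Matrix.of fun i j : Fin 2 => if i.val + j.val + 1 = 2 then (1 : L) else 0)).map (adeleToLocal L v)) γ₂ δ →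
      CompactSpace (Subgroup.centralizer ({δ} : Set ((cmDatum L 2 (Matrix.of fun i j : Fin 2 => if i.val + j.val + 1 = 2 then (1 : L) else 0)).Local v))))
    (hreg : ∀ δ : (cmDatum L 2 (Matrix.of fun i j : Fin 2 => if i.val + j.val + 1 = 2 then (1 : L) else 0)).Local v, IsStablyConj (conjLocal L (IsCMField.complexConj L) v) ((adelicForm L 2 (Matrix.of fun i j : Fin 2 => if i.val + j.val + 1 = 2 then (1 : L) else 0)).map (adeleToLocal L v)) γ₂ δ → IsLocalGRegular L v (δ, γ₁)) :
    stableOrbitalIntegralRel (IsLocalStablyConjH L v) mH f (γ₂, γ₁) =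
      ((∑ j ∈ range (N - i + 1), (if j = 0 then 1 else Nat.card (𝓞 ↥(maximalRealSubfield L) ⧸ v.asIdeal) ^ (j - 1) * (Nat.card (𝓞 ↥(maximalRealSubfield L) ⧸ v.asIdeal) + 1)) : ℕ) : ℂ) := by
  have hc1 : IsCMField.complexConj L ≠ 1 := IsCMField.complexConj_ne_one L
  have hH : ((((adelicForm L 2 (Matrix.of fun i j : Fin 2 => if i.val + j.val + 1 = 2 then (1 : L) else 0)).map (adeleToLocal L v))).map (conjLocal L (IsCMField.complexConj L) v))ᵀ = ((adelicForm L 2 (Matrix.of fun i j : Fin 2 => if i.val + j.val + 1 = 2 then (1 : L) else 0)).map (adeleToLocal L v)) :=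
    map_conjLocal_transpose_localForm L 2 (Matrix.of fun i j : Fin 2 => if i.val + j.val + 1 = 2 then (1 : L) else 0) v (antidiagOne_isHermitian L 2)
  have hHd : IsUnit (((adelicForm L 2 (Matrix.of fun i j : Fin 2 => if i.val + j.val + 1 = 2 then (1 : L) else 0)).map (adeleToLocal L v))).det := isUnit_det_localForm L 2 (Matrix.of fun i j : Fin 2 => if i.val + j.val + 1 = 2 then (1 : L) else 0) v (by rw [Matrix.det_fin_two]; simp [Matrix.of_apply])
  have hγ₂ : γ₂.val ∈ Literature.AlgebraicGeometry.ShimuraVarieties.unitaryGroup (conjLocal L (IsCMField.complexConj L) v) ((adelicForm L 2 (Matrix.of fun i j : Fin 2 => if i.val + j.val + 1 = 2 then (1 : L) else 0)).map (adeleToLocal L v)) :=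
    Literature.AlgebraicGeometry.ShimuraVarieties.mem_unitaryGroup_iff.2 (mem_unitaryGroupOfForm_iff.1 γ₂.2)
  -- ★ (L5-e): the second class
  obtain ⟨g, hg, hT, hst, hnc, hall⟩ := exists_isStablyConj_not_isConj_forall_isConj_or_rankTwo L v (IsCMField.complexConj L)
    (GelbartRogawski1991.UnitaryDualPair.complexConj_imagUnit L) (GelbartRogawski1991.UnitaryDualPair.imagUnit_ne_zero L) w hw hH hHd hγ₂ hP hu hu1
  have hg' : g * γ₂.val * g⁻¹ ∈ UnitaryGroup.«local» L (IsCMField.complexConj L) 2 (Matrix.of fun i j : Fin 2 => if i.val + j.val + 1 = 2 then (1 : L) else 0) v :=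
    mem_unitaryGroupOfForm_iff.2 (Literature.AlgebraicGeometry.ShimuraVarieties.mem_unitaryGroup_iff.1 hg)
  set γ₂' : (cmDatum L 2 (Matrix.of fun i j : Fin 2 => if i.val + j.val + 1 = 2 then (1 : L) else 0)).Local v := ⟨g * γ₂.val * g⁻¹, hg'⟩ with hγ₂'
  have hst' : IsStablyConj (conjLocal L (IsCMField.complexConj L) v) ((adelicForm L 2 (Matrix.of fun i j : Fin 2 => if i.val + j.val + 1 = 2 then (1 : L) else 0)).map (adeleToLocal L v)) γ₂ γ₂' := hst
  have hnc' : ¬ IsConj γ₂ γ₂' := hnc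
  have hall' : ∀ δ : (cmDatum L 2 (Matrix.of fun i j : Fin 2 => if i.val + j.val + 1 = 2 then (1 : L) else 0)).Local v, IsStablyConj (conjLocal L (IsCMField.complexConj L) v) ((adelicForm L 2 (Matrix.of fun i j : Fin 2 => if i.val + j.val + 1 = 2 then (1 : L) else 0)).map (adeleToLocal L v)) γ₂ δ → IsConj γ₂ δ ∨ IsConj γ₂' δ := hall
  -- the eigenframe of the second class: `(g γ₂ g⁻¹)(g P) = (g P) diag(u)`
  have hP' : γ₂'.val.val * (g * P).val = (g * P).val * diagonal u := by
    show (g * γ₂.val * g⁻¹).val * (g * P).val = (g * P).val * diagonal u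
    rw [Units.val_mul, Units.val_mul, Units.val_mul, Matrix.mul_assoc (g.val * γ₂.val.val), ← Matrix.mul_assoc (g⁻¹).val,
      Units.inv_mul, Matrix.one_mul, Matrix.mul_assoc, hP, ← Matrix.mul_assoc]
  haveI : CompactSpace (Subgroup.centralizer ({γ₂'} : Set ((cmDatum L 2 (Matrix.of fun i j : Fin 2 => if i.val + j.val + 1 = 2 then (1 : L) else 0)).Local v))) := hcpt γ₂' hst'
  -- the two class values
  obtain ⟨e₀, he₀, hpar₀, h₀⟩ := exists_classOrbitalIntegral_level_eq_paritySum L v w hw νH hunr hmH hνH γ₂ γ₁ hγ hP hu hu1 hN hi hui f hfc hfK hfinv hf1 hf0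
  obtain ⟨e₁, he₁, hpar₁, h₁⟩ := exists_classOrbitalIntegral_level_eq_paritySum L v w hw νH hunr hmH hνH γ₂' γ₁ (hreg γ₂' hst') hP' hu hu1 hN hi hui f hfc hfK hfinv hf1 hf0
  -- the parity flip: `e₁ ≠ e₀`
  have hflip := even_log_twistGram_apply_iff_not_of_not_normTest L v w hw hunr hH hHd hγ₂ hP hu hu1 hg hT
  have hval' : (g * P).val = g.val * P.val := Units.val_mul _ _
  rw [hval'] at hpar₁
  have hiff : e₁ = 0 ↔ ¬ e₀ = 0 := hpar₁.symm.trans (hflip.trans (not_congr hpar₀))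
  have hsum : e₀ + e₁ = 1 := by
    rcases Nat.eq_zero_or_pos e₀ with h0 | h0
    · have h1 : e₁ ≠ 0 := fun h1 => (hiff.1 h1) h0
      omega
    · have h1 : e₁ = 0 := hiff.2 (by omega)
      omega
  have hS := sum_filter_parity_and_le_add_eq (fun j => if j = 0 then 1 else Nat.card (𝓞 ↥(maximalRealSubfield L) ⧸ v.asIdeal) ^ (j - 1) * (Nat.card (𝓞 ↥(maximalRealSubfield L) ⧸ v.asIdeal) + 1)) N i hsum hiN
  exact stableOrbitalIntegralRel_eq_natCast_of_two_classes_of_values L v mH f γ₂ γ₂' γ₁ hst' hnc' hall' h₀ h₁ hS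

end CM

end Literature.NumberTheory.Automorphic.UnitaryGroup

end
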